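import Literature.NumberTheory.LFunctions.WeilExplicitProofs
import Summits.RiemannHypothesis.RiemannHypothesis.Theorems.WeilGroundStateGroundStatesConvergeToXiStubGroundStateEulerLagrangeStrong
import Literature.NumberTheory.LFunctions.WeilExplicitRightEdge
import Literature.NumberTheory.LFunctions.WeilMellinInversion
import Literature.NumberTheory.LFunctions.WeilSmallSupportPositivity
import Literature.Analysis.SpecialFunctions.DigammaLogBound
import HarnessLib

/-!
# The window image of a test kernel is the Weil functional of its translates, I: polar and prime terms
(route `RiemannHypothesis/GroundBarta`, rung 3 `PolarPerronFrobenius`, stmt-RiemannHypothesis-18390 —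
theta-vector toolkit)

For Weil test functions `g, h` (smooth, compact support) the polarised Weil functional is an
`L²`-pairing of `g` against the TRANSLATE PROFILE of `h`:

  `W(g ⋆ h̃) = ∫ g(u) · conj( W(τ_u h) ) du`,   `(τ_u h)(t) = h(t + u)`,

(`weilFunctional_weilConv_weilReflect_eq_integral_translate`).  Term by term: the polar term of
`τ_u h` is `e^{u/2} ĥ(0) + e^{-u/2} ĥ(1)` and integrates against `g` to
`ĝ(0) conj ĥ(1) + ĝ(1) conj ĥ(0) = ((g ⋆ h̃)^(0) + (g ⋆ h̃)^(1))` (`weilMellin_weilConv`,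
`weilMellin_weilReflect`); the prime terms are finite sums and commute with `∫ g`; the archimedean
term (digamma form) is handled by Fubini on `(u, t) ↦ g(u) e^{itu} conj ĥ(½+it) Re ψ(¼+it/2)`,
integrable since `ĥ` decays like `(1+t²)^{-2}` on the critical line against the logarithmic growth
of `ψ`.  Consequently the window image `u ↦ W(τ_u h)` of a test kernel is an explicit continuous
function, and for Riemann's kernel `Φ` (all of whose translates are Weil-harmonic,
`phi_translate_harmonic`) the window image of the smooth theta window vector `Θ_a = Φχ_a` is
`u ↦ -W(τ_u κ_a)`, `κ_a` the collar tail (next file).  RH-free; elementary given the tree.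
References: Bombieri 2000 §§2–3 (transform calculus), Thm 2 (explicit formula, digamma form).
-/

set_option linter.dupNamespace false

noncomputable section

open Set MeasureTheory Filter Complex
open scoped Real Topology ComplexConjugate ArithmeticFunction.vonMangoldt

namespace Summit.RiemannHypothesis.RiemannHypothesis.Theorems.PolarPerronFrobenius

open Literature.NumberTheory.LFunctions
open Summit.RiemannHypothesis.RiemannHypothesis.Theorems.GroundStatesConvergeToXi

/-! ## Translates: transform and polar term -/

/-- `(τ_u h)^(s) = e^{-(s-1/2)u} ĥ(s)` (substitution `t ↦ t - u`). [folklore] -/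
theorem wi_weilMellin_translate (h : ℝ → ℂ) (u : ℝ) (s : ℂ) :
    weilMellin (fun t => h (t + u)) s = cexp (-((s - 1 / 2) * u)) * weilMellin h s := by
  unfold weilMellin
  have key := integral_add_right_eq_self (μ := (volume : Measure ℝ))
    (fun t : ℝ => h t * cexp ((s - 1 / 2) * (t - u : ℝ))) u
  simp only [add_sub_cancel_right] at key
  rw [key, ← integral_const_mul]
  congr 1 with t
  rw [show ((t - u : ℝ) : ℂ) = (t : ℂ) - (u : ℂ) by push_cast; ring, mul_sub, sub_eq_add_neg,
    Complex.exp_add]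
  ring

/-- The polar term of a translate: `(τ_u h)^(0) + (τ_u h)^(1) = e^{u/2} ĥ(0) + e^{-u/2} ĥ(1)`.
[folklore] -/
theorem wi_weilPolarTerm_translate (h : ℝ → ℂ) (u : ℝ) :
    weilPolarTerm (fun t => h (t + u)) =
      cexp ((u : ℂ) / 2) * weilMellin h 0 + cexp (-((u : ℂ) / 2)) * weilMellin h 1 := by
  rw [weilPolarTerm, wi_weilMellin_translate, wi_weilMellin_translate]
  congr 2 <;> (congr 1; ring)

/-- `ĝ(0) = ∫ g e^{-t/2}` in the form used below. [folklore] -/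
theorem wi_weilMellin_zero (g : ℝ → ℂ) : weilMellin g 0 = ∫ t, g t * cexp (-((t : ℂ) / 2)) := by
  unfold weilMellin; congr 1 with t; congr 1; congr 1; ring

/-- `ĝ(1) = ∫ g e^{t/2}` in the form used below. [folklore] -/
theorem wi_weilMellin_one (g : ℝ → ℂ) : weilMellin g 1 = ∫ t, g t * cexp ((t : ℂ) / 2) := by
  unfold weilMellin; congr 1 with t; congr 1; congr 1; ring

/-! ## The polar term -/

/-- **Polar part of the translate identity**: `∫ g(u) conj(polar(τ_u h)) du = polar(g ⋆ h̃)`.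
[folklore] -/
theorem wi_polar {g h : ℝ → ℂ} (hg : IsWeilTest g) (hh : IsWeilTest h) :
    ∫ u, g u * conj (weilPolarTerm (fun t => h (t + u))) = weilPolarTerm (weilConv g (weilReflect h)) := by
  -- the right-hand side through the transform calculus
  have hR : weilPolarTerm (weilConv g (weilReflect h)) =
      weilMellin g 0 * conj (weilMellin h 1) + weilMellin g 1 * conj (weilMellin h 0) := by
    rw [weilPolarTerm, weilMellin_weilConv_holds hg.1.continuous hg.2 hh.weilReflect.1.continuous
      hh.weilReflect.2, weilMellin_weilConv_holds hg.1.continuous hg.2 hh.weilReflect.1.continuous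
      hh.weilReflect.2, weilMellin_weilReflect_holds, weilMellin_weilReflect_holds]
    simp
  -- the left-hand side: expand the polar term of the translate and integrate term by term
  have hint1 : Integrable fun u : ℝ => g u * cexp (-((u : ℂ) / 2)) :=
    (hg.1.continuous.mul (by fun_prop)).integrable_of_hasCompactSupport hg.2.mul_right
  have hint2 : Integrable fun u : ℝ => g u * cexp ((u : ℂ) / 2) :=
    (hg.1.continuous.mul (by fun_prop)).integrable_of_hasCompactSupport hg.2.mul_right
  have hpt : ∀ u : ℝ, g u * conj (weilPolarTerm (fun t => h (t + u))) =
      conj (weilMellin h 0) * (g u * cexp ((u : ℂ) / 2)) +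
        conj (weilMellin h 1) * (g u * cexp (-((u : ℂ) / 2))) := by
    intro u
    rw [wi_weilPolarTerm_translate, map_add, map_mul, map_mul, ← Complex.exp_conj, ← Complex.exp_conj,
      map_neg, map_div₀, Complex.conj_ofReal, map_ofNat]
    ring
  simp_rw [hpt]
  rw [integral_add (hint2.const_mul _) (hint1.const_mul _), integral_const_mul, integral_const_mul,
    ← wi_weilMellin_one, ← wi_weilMellin_zero, hR]
  ring

/-! ## The prime term -/

/-- A radius for a compactly supported function: `f t ≠ 0 → |t| ≤ R`. [folklore] -/
theorem wi_exists_radius {f : ℝ → ℂ} (hf : HasCompactSupport f) :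
    ∃ R : ℝ, 0 ≤ R ∧ ∀ t, f t ≠ 0 → |t| ≤ R := by
  obtain ⟨R, hR⟩ := hf.isCompact.isBounded.subset_closedBall 0
  refine ⟨max R 0, le_max_right _ _, fun t ht => ?_⟩
  have h1 := hR (subset_tsupport _ (Function.mem_support.2 ht))
  rw [Metric.mem_closedBall, dist_zero_right, Real.norm_eq_abs] at h1
  exact h1.trans (le_max_left _ _)

/-- The prime coefficients `Λ(n) n^{-1/2}` are real: `conj c_n = c_n`. [folklore] -/
theorem wi_conj_coeff (n : ℕ) :
    conj (((Λ n : ℝ) : ℂ) / (Real.sqrt n : ℂ)) = ((Λ n : ℝ) : ℂ) / (Real.sqrt n : ℂ) := by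
  rw [map_div₀, Complex.conj_ofReal, Complex.conj_ofReal]

/-- **Prime part of the translate identity**: `∫ g(u) conj(prime(τ_u h)) du = prime(g ⋆ h̃)`.  Both
prime sums are finite (compact supports), so the exchange with `∫ g` is elementary. [folklore] -/
theorem wi_prime {g h : ℝ → ℂ} (hg : IsWeilTest g) (hh : IsWeilTest h) :
    ∫ u, g u * conj (weilPrimeTerm (fun t => h (t + u))) = weilPrimeTerm (weilConv g (weilReflect h)) := by
  obtain ⟨Rg, hRg0, hRg⟩ := wi_exists_radius hg.2
  obtain ⟨Rh, hRh0, hRh⟩ := wi_exists_radius hh.2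
  set N : ℕ := ⌈Real.exp (Rg + Rh + 1)⌉₊ with hN
  set S : Finset ℕ := Finset.range N with hS
  set c : ℕ → ℂ := fun n => ((Λ n : ℝ) : ℂ) / (Real.sqrt n : ℂ) with hc
  set F : ℝ → ℂ := weilConv g (weilReflect h) with hF
  -- beyond `S` the shifts leave the supports
  have hlog : ∀ n, n ∉ S → Rg + Rh + 1 ≤ Real.log n := by
    intro n hn
    rw [hS, Finset.mem_range, not_lt] at hn
    have hn' : Real.exp (Rg + Rh + 1) ≤ n := (Nat.le_ceil _).trans (by exact_mod_cast hn)
    have hpos : (0 : ℝ) < n := (Real.exp_pos _).trans_le hn'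
    rwa [Real.le_log_iff_exp_le hpos]
  have hvan : ∀ n, n ∉ S → ∀ u : ℝ, g u ≠ 0 →
      h (Real.log n + u) = 0 ∧ h (-Real.log n + u) = 0 := by
    intro n hn u hgu
    have hl := hlog n hn
    have hu := abs_le.1 (hRg u hgu)
    constructor
    · by_contra hne
      have h1 := abs_le.1 (hRh _ hne)
      linarith [h1.2]
    · by_contra hne
      have h1 := abs_le.1 (hRh _ hne)
      linarith [h1.1]
  -- (i) the left-hand side is a finite sum under the integral
  have hL : ∀ u : ℝ, g u * conj (weilPrimeTerm (fun t => h (t + u))) =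
      ∑ n ∈ S, c n * (g u * conj (h (Real.log n + u)) + g u * conj (h (-Real.log n + u))) := by
    intro u
    by_cases hgu : g u = 0
    · simp [hgu]
    · have h1 : weilPrimeTerm (fun t => h (t + u)) =
          ∑ n ∈ S, c n * (h (Real.log n + u) + h (-Real.log n + u)) := by
        unfold weilPrimeTerm
        refine tsum_eq_sum fun n hn => ?_
        obtain ⟨e1, e2⟩ := hvan n hn u hgu
        simp only [e1, e2, add_zero, mul_zero]
      rw [h1, map_sum, Finset.mul_sum]
      refine Finset.sum_congr rfl fun n _ => ?_
      rw [map_mul, wi_conj_coeff, map_add]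
      ring
  -- (ii) the right-hand side is a finite sum
  have hzero : ∀ n, n ∉ S → F (Real.log n) = 0 ∧ F (-Real.log n) = 0 := by
    intro n hn
    constructor
    · rw [hF, weilConv_weilReflect_apply_eq_integral_mul_conj]
      have e : (fun t => g t * conj (h (t - Real.log n))) = fun _ => 0 := by
        funext t
        by_cases hgt : g t = 0
        · simp [hgt]
        · rw [show t - Real.log n = -Real.log n + t by ring, (hvan n hn t hgt).2, map_zero, mul_zero]
      rw [e, integral_zero]
    · rw [hF, weilConv_weilReflect_apply_eq_integral_mul_conj]
      have e : (fun t => g t * conj (h (t - -Real.log n))) = fun _ => 0 := by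
        funext t
        by_cases hgt : g t = 0
        · simp [hgt]
        · rw [show t - -Real.log n = Real.log n + t by ring, (hvan n hn t hgt).1, map_zero, mul_zero]
      rw [e, integral_zero]
  have hR : weilPrimeTerm F = ∑ n ∈ S, c n * (F (Real.log n) + F (-Real.log n)) := by
    unfold weilPrimeTerm
    refine tsum_eq_sum fun n hn => ?_
    obtain ⟨e1, e2⟩ := hzero n hn
    rw [e1, e2, add_zero, mul_zero]
  -- (iii) the pairings `∫ g(u) conj h(±log n + u) du = F(∓log n)`
  have hpair : ∀ x : ℝ, ∫ u, g u * conj (h (x + u)) = F (-x) := fun x => by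
    rw [hF, weilConv_weilReflect_apply_eq_integral_mul_conj]
    congr 1 with u
    rw [show u - -x = x + u by ring]
  have hint : ∀ x : ℝ, Integrable fun u : ℝ => g u * conj (h (x + u)) := fun x =>
    (hg.1.continuous.mul (Complex.continuous_conj.comp
      (hh.1.continuous.comp (continuous_const.add continuous_id)))).integrable_of_hasCompactSupport
      hg.2.mul_right
  -- assemble
  simp_rw [hL]
  rw [integral_finsetSum S
    (f := fun n u => c n * (g u * conj (h (Real.log n + u)) + g u * conj (h (-Real.log n + u))))
    fun n _ => ?_, hR]
  · refine Finset.sum_congr rfl fun n _ => ?_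
    rw [integral_const_mul, integral_add (hint _) (hint _), hpair, hpair, neg_neg, add_comm]
  · have h1 := ((hint (Real.log n)).add (hint (-Real.log n))).const_mul (c n)
    simpa only [Pi.add_apply] using h1

end Summit.RiemannHypothesis.RiemannHypothesis.Theorems.PolarPerronFrobenius

end
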